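import Mathlib
import HarnessLib
import Summits.SmoothPoincare4.SmoothPoincare4.Theses.CongruenceShadows

/-!
# Sketch — crux ideas for `NormalFormStablyTrivial` (stmt-SmoothPoincare4-14591), ideator 1, round 1

Normal-form dictionary.  `g = 3+3m`, `S m = S_g`, `N m = s4Kernels.stabilizeIter m` (standard triple),
`HStab m i` = stabiliser of `N m i` in `Aut S` (handlebody group of `H_i`, ± allowed),
`X = HStab 0 ∩ HStab 1` (Goeritz group of the standard pair `(H₀,H₁)`), `Y = HStab 1 ∩ HStab 2`.
A Waldhausen-normalised trisection of `{1}` is `twisted m β = (N₀, N₁, β N₂)` with `InGate m β`.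
It is standard iff `β ∈ X * Y` (as a product in `MulAut`).

Card 1 (`kt-slide-defect-collapse`): `P1` = stabiliser of the standard meridian system of `H₁`
(algebraic stand-in for the stabiliser of the standard cut system); semi-simultaneity `β ∈ X * P1 * Y`
is the Kirby–Thompson condition `l_{H₁} = 0`; K1 = `SlideDefectCollapse`, K2 = `SemiSimultaneousStablyStandard`.

Card 2 (`luft-twist-reduction`): `TwistGroup` = Luft twist group of `H₁` (acts innerly on `S/N₁`);
L1 = `LuftReduction`, L2 = `TwistGate`, Lemma R = `GoeritzRealisesOutStab01`.
-/

set_option linter.dupNamespace false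

namespace Summit.SmoothPoincare4.SmoothPoincare4.Cruxes.NormalFormStablyTrivial.SketchIdeator1

open Literature.Topology.FourManifolds

noncomputable section

/-- the surface group at level `m` (genus `3+3m`). -/
abbrev S (m : ℕ) : Type := SurfaceGroup (3 + 3 * m)

/-- the standard (stabilised `S⁴`) kernel triple at level `m`. -/
abbrev N (m : ℕ) : TrisectionKernels (3 + 3 * m) := s4Kernels.stabilizeIter m

variable (m : ℕ)

/-- handlebody group of `H_i`: automorphisms preserving the kernel `N_i`. -/
def HStab (i : Fin 3) : Set (S m ≃* S m) := {φ | (N m i).map φ.toMonoidHom = N m i}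

/-- Goeritz group of the standard pair `(H₀,H₁)` (= `A ∩ B`). -/
def X : Set (S m ≃* S m) := HStab m 0 ∩ HStab m 1

/-- Goeritz group of the standard pair `(H₁,H₂)` (= `B ∩ C`). -/
def Y : Set (S m ≃* S m) := HStab m 1 ∩ HStab m 2

/-- index of the `r`-th handle of the `j`-th genus-3 block. -/
def blk (j : Fin (m + 1)) (r : Fin 3) : Fin (3 + 3 * m) := ⟨3 * j.val + r.val, by omega⟩

/-- the standard meridian ELEMENTS of `H₁`: `a_{3j}, b_{3j+1}, a_{3j+2}` (they normally generate `N m 1`). -/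
def stdMeridians1 : Set (S m) :=
  {x | ∃ j : Fin (m + 1), x = SurfaceGroup.a (blk m j 0) ∨ x = SurfaceGroup.b (blk m j 1) ∨
      x = SurfaceGroup.a (blk m j 2)}

/-- `P1`: automorphisms permuting the conjugacy classes of the standard `H₁`-meridians up to inversion
(algebraic stand-in for the stabiliser of the standard cut system of `H₁`; by Dehn–Nielsen–Baer and
"homotopic simple curves are isotopic" it IS that stabiliser inside `Mod±`). -/
def P1 : Set (S m ≃* S m) :=
  {φ | (∀ x ∈ stdMeridians1 m, ∃ y ∈ stdMeridians1 m, ∃ s : S m,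
          φ x = s * y * s⁻¹ ∨ φ x = s * y⁻¹ * s⁻¹) ∧
       (∀ x ∈ stdMeridians1 m, ∃ y ∈ stdMeridians1 m, ∃ s : S m,
          φ.symm x = s * y * s⁻¹ ∨ φ.symm x = s * y⁻¹ * s⁻¹)}

/-- the kernel triple `(N₀, N₁, β N₂)`. -/
def twisted (β : S m ≃* S m) : TrisectionKernels (3 + 3 * m) :=
  ![N m 0, N m 1, (N m 2).map β.toMonoidHom]

/-- the homotopy-sphere gate in normal form: `β ∈ B`, `(N₀, βN₂)` is a standard pair, triple quotient trivial. -/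
def InGate (β : S m ≃* S m) : Prop :=
  β ∈ HStab m 1 ∧
  (∃ α : S m ≃* S m, α ∈ HStab m 0 ∧ (N m 2).map α.toMonoidHom = (N m 2).map β.toMonoidHom) ∧
  Subgroup.normalClosure ((((N m 0 : Subgroup (S m)) : Set (S m)) ∪ (N m 1 : Subgroup (S m))) ∪
      ((N m 2).map β.toMonoidHom : Subgroup (S m))) = ⊤

/-- standard normal form: `β ∈ X·Y`. -/
def Standard (β : S m ≃* S m) : Prop := ∃ x ∈ X m, ∃ y ∈ Y m, β = x * y

/-! ## Card 1 — Kirby–Thompson slide defect -/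

/-- semi-simultaneity (`l_{H₁} = 0`): `β ∈ X · P1 · Y`. -/
def SemiSimultaneous (β : S m ≃* S m) : Prop :=
  ∃ x ∈ X m, ∃ p ∈ P1 m, ∃ y ∈ Y m, β = x * p * y

/-- FIRST LEMMA (Card 1): the meridian-system stabiliser lies in the handlebody group `B = HStab 1`
(so the triple product `X·P1·Y` lives inside `B`, and `X·P1·Y = X·Y ↔ P1 ⊆ X·Y`). -/
def P1_subset_B : Prop := ∀ φ ∈ P1 m, φ ∈ HStab m 1

/-- Iso-invariance: semi-simultaneity is a property of the trisection, not of the chosen `β`. -/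
def SemiSimultaneous_iso_invariant : Prop :=
  ∀ β β' : S m ≃* S m, β ∈ HStab m 1 → β' ∈ HStab m 1 →
    TrisectionKernels.Iso (twisted m β) (twisted m β') →
    (SemiSimultaneous m β ↔ SemiSimultaneous m β')

/-- K1 (crux, rank 2): SLIDE-DEFECT COLLAPSE — every homotopy-sphere normal form becomes semi-simultaneous
after finitely many stabilisations (Kirby 4.18 for homotopy spheres, in Goeritz double-coset form). -/
def SlideDefectCollapse : Prop :=
  ∀ (m : ℕ) (β : S m ≃* S m), InGate m β →
    ∃ n : ℕ, ∃ β' : S (m + n) ≃* S (m + n), InGate (m + n) β' ∧ SemiSimultaneous (m + n) β' ∧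
      TrisectionKernels.Iso (((twisted m β).stabilizeIter n).cast (by ring)) (twisted (m + n) β')

/-- K2 (crux, shared content with `NoOneHandles.NoohGscStandard` via Asano–Naoe–Ogawa Prop 3.1):
semi-simultaneous homotopy-sphere normal forms are stably trivial. -/
def SemiSimultaneousStablyStandard : Prop :=
  ∀ (m : ℕ) (β : S m ≃* S m), InGate m β → SemiSimultaneous m β → (twisted m β).IsStablyTrivial

/-! ## Card 2 — Luft twist-group reduction -/

/-- `t` acts on `S/N₁ = π₁(H₁)` as an inner automorphism. -/
def ActsInnerlyModN1 (t : S m ≃* S m) : Prop :=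
  ∃ g : S m, ∀ s : S m, (t s) * (g * s * g⁻¹)⁻¹ ∈ N m 1

/-- the Luft twist group of `H₁` (kernel of `Mod(H₁) → Out π₁H₁`; generated by meridian-disc twists). -/
def TwistGroup : Set (S m ≃* S m) := {t | t ∈ HStab m 1 ∧ ActsInnerlyModN1 m t}

/-- Lemma R for the pair `(H₀,H₁)`: the Goeritz group realises the whole `Out`-stabiliser of
`P̄₀ = ker(π₁H₁ → π₁(H₀ ∪ H₁))`. -/
def GoeritzRealisesOutStab01 : Prop :=
  ∀ (m : ℕ) (φ : S m ≃* S m), φ ∈ HStab m 1 →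
    (N m 0 ⊔ N m 1).map φ.toMonoidHom = N m 0 ⊔ N m 1 →
    ∃ x ∈ X m, ActsInnerlyModN1 m (x⁻¹ * φ)

/-- L1 (support→crux, rank 3): LUFT REDUCTION — stably the gluing lies in the twist group. -/
def LuftReduction : Prop :=
  ∀ (m : ℕ) (β : S m ≃* S m), InGate m β →
    ∃ n : ℕ, ∃ t ∈ TwistGroup (m + n), InGate (m + n) t ∧
      TrisectionKernels.Iso (((twisted m β).stabilizeIter n).cast (by ring)) (twisted (m + n) t)

/-- L2 (crux, rank 2): TWIST GATE — the crux for twist-group gluings. -/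
def TwistGate : Prop :=
  ∀ (m : ℕ) (t : S m ≃* S m), t ∈ TwistGroup m → InGate m t → (twisted m t).IsStablyTrivial

/-! ## Shared supports and the two compositions -/

/-- normal-form extraction (support): a pairwise-standard trisection of `{1}` is Iso to some `twisted m β`
with `β` in the gate. -/
def NormalFormExtraction : Prop :=
  ∀ (m : ℕ) (K : TrisectionKernels (3 + 3 * m)),
    IsGroupTrisection (3 + 3 * m) (m + 1) (PUnit : Type) K →
    (∀ i j : Fin 3, i ≠ j → ∃ α : S m ≃* S m,
        (N m i).map α.toMonoidHom = K i ∧ (N m j).map α.toMonoidHom = K j) →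
    ∃ β : S m ≃* S m, InGate m β ∧ TrisectionKernels.Iso K (twisted m β)

/-- stable bookkeeping (support): `IsStablyTrivial` is invariant under `Iso` and detected after
stabilisation. -/
def StableBookkeeping : Prop :=
  (∀ (g : ℕ) (K K' : TrisectionKernels g), TrisectionKernels.Iso K K' →
      K'.IsStablyTrivial → K.IsStablyTrivial) ∧
  (∀ (m n : ℕ) (K : TrisectionKernels (3 + 3 * m)) (h : 3 + 3 * m + 3 * n = 3 + 3 * (m + n)),
      ((K.stabilizeIter n).cast h).IsStablyTrivial → K.IsStablyTrivial)

/-- Card 1 composition: K1 ∧ K2 (+ supports) ⇒ the crux, by name. -/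
theorem crux_of_slideDefect (hE : NormalFormExtraction) (hB : StableBookkeeping)
    (h1 : SlideDefectCollapse) (h2 : SemiSimultaneousStablyStandard) :
    Summit.SmoothPoincare4.SmoothPoincare4.Theses.CongruenceShadows.NormalFormStablyTrivial := by
  intro m K hK hpairs
  obtain ⟨β, hgate, hiso⟩ := hE m K hK hpairs
  obtain ⟨n, β', hgate', hss, hiso'⟩ := h1 m β hgate
  have h' : (twisted (m + n) β').IsStablyTrivial := h2 (m + n) β' hgate' hss
  have hh : 3 + 3 * m + 3 * n = 3 + 3 * (m + n) := by ring
  have h'' : (((twisted m β).stabilizeIter n).cast hh).IsStablyTrivial := hB.1 _ _ _ hiso' h'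
  exact hB.1 _ _ _ hiso (hB.2 m n (twisted m β) hh h'')

/-- Card 2 composition: L1 ∧ L2 (+ supports) ⇒ the crux, by name. -/
theorem crux_of_luft (hE : NormalFormExtraction) (hB : StableBookkeeping)
    (hL : LuftReduction) (hT : TwistGate) :
    Summit.SmoothPoincare4.SmoothPoincare4.Theses.CongruenceShadows.NormalFormStablyTrivial := by
  intro m K hK hpairs
  obtain ⟨β, hgate, hiso⟩ := hE m K hK hpairs
  obtain ⟨n, t, ht, hgate', hiso'⟩ := hL m β hgate
  have h' : (twisted (m + n) t).IsStablyTrivial := hT (m + n) t ht hgate'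
  have hh : 3 + 3 * m + 3 * n = 3 + 3 * (m + n) := by ring
  have h'' : (((twisted m β).stabilizeIter n).cast hh).IsStablyTrivial := hB.1 _ _ _ hiso' h'
  exact hB.1 _ _ _ hiso (hB.2 m n (twisted m β) hh h'')

/-- sanity: a standard normal form is semi-simultaneous (take `p = 1`). -/
theorem semiSimultaneous_of_standard (β : S m ≃* S m) (h : Standard m β)
    (h1 : (1 : S m ≃* S m) ∈ P1 m) : SemiSimultaneous m β := by
  obtain ⟨x, hx, y, hy, rfl⟩ := h
  exact ⟨x, hx, 1, h1, y, hy, by rw [mul_one]⟩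

end

end Summit.SmoothPoincare4.SmoothPoincare4.Cruxes.NormalFormStablyTrivial.SketchIdeator1
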